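import Summits.NavierStokesRegularity.FluidComputer.EnstrophyComparison
import HarnessLib

/-!
# Fluid computer — support: comparison for the quadratic (Riccati) integral inequality

HONEST FRAMING (cell `pub-fluidc`, verbatim): *low prior, high value-of-information experiment on Tao's
machine paradigm; NOT a claim that NS blows up.* Support file (pure real analysis, no fluid content): the ODE
comparison for the RICCATI integral inequality `G(b) ≤ G(0) + L ∫₀ᵇ G²` — the companion of
`EnstrophyComparison.sq_mul_le_of_cubic` (the cubic case behind Leray's speed limit L24) for the quadratic law behind
the `Ḣ^{3/2}` Riccati inequality of Cheskidov–Zaya 2016 (Thm. 2.2, `y' ≲ ν⁻¹ y²`; summation step in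
`RiccatiSummation`): `mul_le_of_sq` — `G(b) · (1 − L G(0) b) ≤ G(0)` on `[0, b₀]`, i.e. `G(b) ≤ G(0)/(1 − L G(0) b)` while
`L G(0) b < 1`. Read backwards from a blow-up time this is the lower bound `G(t) ≥ 1/(L (T − t))`. 0 sorry; no
definitions.

## References

* A. Cheskidov, K. Zaya, J. Math. Phys. 57 (2016) 023101 = arXiv:1503.01784, Thm. 2.2 / Thm. 2.4.
  [CheskidovZaya2016]
-/

noncomputable section

open MeasureTheory Set Filter Topology intervalIntegral

namespace Summit.NavierStokesRegularity.FluidComputer.RiccatiComparison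

/-- **Comparison for the quadratic integral inequality (Bernoulli majorant).** Let `G` be continuous and
nonnegative on `[0, b₀]` with `G(0) > 0`, let `L ≥ 0`, and suppose `G(b) ≤ G(0) + L ∫₀ᵇ G(t)² dt` for every
`b ∈ [0, b₀]`. Then `G(b) · (1 − L G(0) b) ≤ G(0)` for every `b ∈ [0, b₀]` — i.e. `G(b) ≤ G(0)/(1 − L G(0) b)` while
`L G(0) b < 1` (and trivially otherwise). [cite: CheskidovZaya2016, Thm. 2.2 (proof) and Thm. 2.4] -/
theorem mul_le_of_sq {G : ℝ → ℝ} {L b₀ : ℝ} (hL : 0 ≤ L) (hb₀ : 0 < b₀)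
    (hGc : ContinuousOn G (Icc 0 b₀)) (hG0 : ∀ t ∈ Icc 0 b₀, 0 ≤ G t) (hpos : 0 < G 0)
    (hineq : ∀ b ∈ Icc 0 b₀, G b ≤ G 0 + L * ∫ t in (0 : ℝ)..b, G t ^ 2) :
    ∀ b ∈ Icc 0 b₀, G b * (1 - L * G 0 * b) ≤ G 0 := by
  intro b hb
  -- the majorant `H(t) = G(0) + L ∫₀ᵗ G²`
  set H : ℝ → ℝ := fun t => G 0 + L * ∫ s in (0 : ℝ)..t, G s ^ 2 with hH
  have hG2c : ContinuousOn (fun s => G s ^ 2) (Icc 0 b₀) := hGc.pow 2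
  have hint : ∀ t ∈ Icc 0 b₀, IntervalIntegrable (fun s => G s ^ 2) volume 0 t := fun t ht =>
    (hG2c.mono (Icc_subset_Icc le_rfl ht.2)).intervalIntegrable_of_Icc ht.1
  have hGH : ∀ t ∈ Icc 0 b₀, G t ≤ H t := fun t ht => hineq t ht
  have hH0 : H 0 = G 0 := by simp [hH]
  have hHge : ∀ t ∈ Icc 0 b₀, G 0 ≤ H t := by
    intro t ht
    have h0 : 0 ≤ ∫ s in (0 : ℝ)..t, G s ^ 2 :=
      intervalIntegral.integral_nonneg ht.1 fun s _ => sq_nonneg _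
    have : 0 ≤ L * ∫ s in (0 : ℝ)..t, G s ^ 2 := mul_nonneg hL h0
    simp only [hH]
    linarith
  have hHpos : ∀ t ∈ Icc 0 b₀, 0 < H t := fun t ht => hpos.trans_le (hHge t ht)
  -- continuity of `H` on `[0, b₀]`
  have hHc : ContinuousOn H (Icc 0 b₀) := by
    have hprim : ContinuousOn (fun t => ∫ s in (0 : ℝ)..t, G s ^ 2) (Icc 0 b₀) := by
      have hIo : IntegrableOn (fun s => G s ^ 2) (uIcc 0 b₀) volume := by
        rw [uIcc_of_le hb₀.le]
        exact hG2c.integrableOn_Icc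
      have h := intervalIntegral.continuousOn_primitive_interval hIo
      rwa [uIcc_of_le hb₀.le] at h
    exact continuousOn_const.add (continuousOn_const.mul hprim)
  -- derivative of `H` in the interior
  have hHd : ∀ t ∈ Ioo 0 b₀, HasDerivAt H (L * G t ^ 2) t := by
    intro t ht
    have htI : t ∈ Icc 0 b₀ := Ioo_subset_Icc_self ht
    have hca : ContinuousAt (fun s => G s ^ 2) t := hG2c.continuousAt (Icc_mem_nhds ht.1 ht.2)
    have hmeas : StronglyMeasurableAtFilter (fun s => G s ^ 2) (𝓝 t) volume :=
      (hG2c.mono Ioo_subset_Icc_self).stronglyMeasurableAtFilter isOpen_Ioo t ht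
    have h1 : HasDerivAt (fun u => ∫ s in (0 : ℝ)..u, G s ^ 2) (G t ^ 2) t :=
      intervalIntegral.integral_hasDerivAt_right (hint t htI) hmeas hca
    exact (h1.const_mul L).const_add (G 0)
  -- the function `φ = -1/H` and its derivative `L G²/H² ≤ L`
  set φ : ℝ → ℝ := fun t => -(H t)⁻¹ with hφ
  have hφd : ∀ t ∈ Ioo 0 b₀, HasDerivAt φ (L * G t ^ 2 / H t ^ 2) t := by
    intro t ht
    have hHt : 0 < H t := hHpos t (Ioo_subset_Icc_self ht)
    have h2 := ((hHd t ht).inv hHt.ne').neg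
    refine h2.congr_deriv ?_
    field_simp
  have hφle : ∀ t ∈ Ioo 0 b₀, L * G t ^ 2 / H t ^ 2 ≤ L := by
    intro t ht
    have htI : t ∈ Icc 0 b₀ := Ioo_subset_Icc_self ht
    have hHt : 0 < H t := hHpos t htI
    have hq : G t / H t ≤ 1 := (div_le_one hHt).2 (hGH t htI)
    have hq0 : 0 ≤ G t / H t := div_nonneg (hG0 t htI) hHt.le
    have hq2 : (G t / H t) ^ 2 ≤ 1 := pow_le_one₀ hq0 hq
    calc L * G t ^ 2 / H t ^ 2 = L * (G t / H t) ^ 2 := by rw [div_pow]; ring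
      _ ≤ L * 1 := mul_le_mul_of_nonneg_left hq2 hL
      _ = L := mul_one L
  -- mean value inequality on `[0, b]`
  have hφc : ContinuousOn φ (Icc 0 b) := by
    have hHc' : ContinuousOn H (Icc 0 b) := hHc.mono (Icc_subset_Icc le_rfl hb.2)
    refine (hHc'.inv₀ fun t ht => ?_).neg
    exact (hHpos t ⟨ht.1, ht.2.trans hb.2⟩).ne'
  have hφdiff : DifferentiableOn ℝ φ (interior (Icc 0 b)) := by
    rw [interior_Icc]
    intro t ht
    exact (hφd t ⟨ht.1, ht.2.trans_le hb.2⟩).differentiableAt.differentiableWithinAt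
  have hφ' : ∀ t ∈ interior (Icc 0 b), deriv φ t ≤ L := by
    rw [interior_Icc]
    intro t ht
    have ht' : t ∈ Ioo 0 b₀ := ⟨ht.1, ht.2.trans_le hb.2⟩
    rw [(hφd t ht').deriv]
    exact hφle t ht'
  have hmv := (convex_Icc 0 b).image_sub_le_mul_sub_of_deriv_le hφc hφdiff hφ' 0 (left_mem_Icc.2 hb.1) b
    (right_mem_Icc.2 hb.1) hb.1
  -- `φ b - φ 0 ≤ L b`, i.e. `1/G(0) - 1/H(b) ≤ L b`
  have hHb : 0 < H b := hHpos b hb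
  have hφ0 : φ 0 = -(G 0)⁻¹ := by simp only [hφ, hH0]
  have hφb : φ b = -(H b)⁻¹ := rfl
  rw [hφ0, hφb, sub_zero] at hmv
  -- conclude
  by_cases hD : 1 - L * G 0 * b ≤ 0
  · calc G b * (1 - L * G 0 * b) ≤ 0 := mul_nonpos_of_nonneg_of_nonpos (hG0 b hb) hD
      _ ≤ G 0 := hpos.le
  · rw [not_le] at hD
    have key : (1 - L * G 0 * b) * H b ≤ G 0 := by
      have h1 : (G 0)⁻¹ - L * b ≤ (H b)⁻¹ := by linarith
      have h2 : (1 - L * G 0 * b) / G 0 ≤ 1 / H b := by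
        have e1 : (1 - L * G 0 * b) / G 0 = (G 0)⁻¹ - L * b := by
          field_simp
        rw [e1, one_div]
        exact h1
      rw [div_le_div_iff₀ hpos hHb] at h2
      nlinarith [h2]
    calc G b * (1 - L * G 0 * b) ≤ H b * (1 - L * G 0 * b) :=
          mul_le_mul_of_nonneg_right (hGH b hb) hD.le
      _ = (1 - L * G 0 * b) * H b := by ring
      _ ≤ G 0 := key

end Summit.NavierStokesRegularity.FluidComputer.RiccatiComparison

end
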